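import Mathlib
import Literature.MathematicalPhysics.QuantumFieldTheory.Balaban1983to89.Beta.VolumeConvolution

/-!
# `Balaban1983to89.Beta.EntrywiseVolumeLimit` — ENTRYWISE VOLUME LIMITS `T ↗ ℤ^d` OF THE TORUS GREEN'S FUNCTIONS OF
# BLOCK-PERIODIC OPERATORS: the two-variable periodisation `periodise₂`, the BLOCK-PERIODIC Lemma 2.2.2 (the torus inverse
# IS the periodisation of the `ℤ^d` inverse — for operators that are only `s·ℤ^d`-covariant, which is all a one-shot block
# operator `−Δ + a Q*Q (+ m²)` is), the entrywise limit `G_t([x],[y]) → S(x,y)` with the EXPLICIT image-tail rate per base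
# point (constants free of the base point and of the volume), the transfer «volume-uniform bound ⟹ bound of the limit»,
# and the finite-range dictionary «torus stencil operator = periodised `ℤ^d` stencil operator»

β sub-cell of the audit cell `pub-balaban`, row BETA-an4 (the k-uniform remainder lineage), unit `b2b-balaban-beta-an4`
gen 9, journal claim AN4-VOLUME-LIMIT-IIA = item **(ii-a)** of BETA-SPEC §7.24 RULING (R13-1)(b) / §7.25 (R14-5) («(ii-a)
SHARED BY ROAD: an4 = the IMAGES half for massive block-localised entries given `K^∞` as labelled input ∥ an5 = the
RIEMANN-SUM half»).  Bookkeeping BY NAME over `Beta/VolumeImages`, `Beta/VolumeConvolution`, `Beta/InfiniteVolume`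
(b2b-balaban-pv04 / an4 lineages: `imageShift`, `imageTail`, `IsImageSum`, `ScalarVolumeRate`,
`IsImageSum.scalarVolumeRate`, `tendsto_imageTail_side`, `tsum_eq_sum_tsum_imageShift`, `windowMap` / `siteOf` /
`InWindow` / `eventually_inWindow`); nothing imported is modified, no engine of another row is re-proved (dedup rule
(R14-5): the momentum-side periodisation `B4TorusKernel` / `Beta/VolumePeriodise` and an5's Riemann sums are neither
imported nor duplicated — they treat ONE-variable, translation-invariant multiplier kernels; this module treats
TWO-variable kernels with block periodicity only, where no scalar multiplier exists).

T. Bałaban, *Renormalization group approach to lattice gauge field theories. I*, Commun. Math. Phys. **109**, 249–301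
(1987) [Balaban1987RG1] (cell paper B12; PDF page = journal page − 248); T. Bałaban, *Propagators and renormalization
transformations for lattice gauge theories. I*, Commun. Math. Phys. **95**, 17–40 (1984) [Balaban1984PropagatorsI] (cell
paper B5).  PROVENANCE of §§2–3 (a published lemma, PROVED here in the generality needed, not cited as a fact): G. Slade,
*Critical exponents for long-range O(n) models below the upper critical dimension*, Commun. Math. Phys. **358** (2018),
arXiv:1611.06169, §2.2.3 Lemma 2.2.2 [Slade2017].

HONEST FRAMING (cell `pub-balaban`, BETA-SPEC, verbatim): discharging `BetaPertH` makes Bałaban's UV stability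
UNCONDITIONAL — a real constructive-QFT result; it is NOT the continuum limit and NOT the Clay problem.  THIS MODULE
ASSERTS NOTHING about Bałaban's kernels, nothing about β, and discharges no leaf of the β sub-cell's wall: it is
[folklore] operator bookkeeping on `ℤ^d` and on cubic tori `(ℤ/s)^d`, every hypothesis a binder.  Value = a
dictionary/limit-grade TYPED INPUT for the window rows of (R13)/(R14) (the entries `K^𝕋_n(x₀ + w, x₀) → K^∞_n(x₀ + w, x₀)`
GIVEN the infinite-volume Green's function `K^∞_n` with its decay as a LABELLED input), NOT summit progress.

WHAT THE PAPERS PRINT (CONTEXT ONLY; NOTHING IS NEWLY QUOTED — the two fragments below are the render-checked wordings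
already carried by `Beta/InfiniteVolume`, `Beta/LocalizedVolumeRate` and `Beta/VolumePeriodise`).  B12 p. 264 [PDF 16],
after (1.21): *"Now we take a limit of these functions as T^{(j+1)} ↗ Z^d. This limit exists by the localized
representation (1.7)."*  B5 p. 36 [PDF 20]: *"Probably the simplest proof of the exponential decay properties can be
obtained by relating G on the torus to G on the whole lattice ηZ^d in the usual way, …"*.  Neither paper prints the
periodisation identity for a block operator, an entrywise rate, or the transfer; "the usual way" is what this module makes
explicit for block-periodic operators.  Slade's Lemma 2.2.2 (wording as quoted from arXiv:1611.06169 pp. 10–11 in the tree file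
`Literature/Barriers/CriticalPhenomena/RigorousRGSmallParameterTorusResolvent.lean`, which PROVES it for fully
translation-invariant `T`, `T_{x'+z',y'+z'} = T_{x',y'}`, on its own carriers): *"Define (T̂_{x,y})_{x,y∈Λ} by T̂_{x,y} =
Σ_{y'~y} T_{x,y'} … Then T̂ has inverse matrix T̂⁻¹_{x,y} = Σ_{y'~y} T⁻¹_{x,y'}."*, printed proof *"The assumed translation
invariance for T implies the same for T⁻¹"*, then *"Σ_{y∈Λ} T̂_{x,y} Ŝ_{y,z} = Σ_{y∈Λ}Σ_{y'~y} T_{x,y'} Σ_{z''~z}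
T⁻¹_{y',z''} = Σ_{z''~z} δ_{x,z''} = δ_{x,z}"*.  That file is NOT imported (its hypothesis is full translation invariance,
which a block operator lacks, and its import chain is the long-range-model barrier's); the block-periodic version is proved
below from scratch on the β sub-cell's carriers, by the printed argument.

WHAT THIS MODULE PROVES (zero `sorry`; every theorem [folklore] or a composition by name).
§1  KERNELS ON `ℤ^d`.  `Kernel₂ d = ℤ^d → ℤ^d → ℝ`; `IsPeriodic₂ s K` (JOINT `s·ℤ^d`-periodicity `K(x+sn, y+sn) = K(x,y)`,
    with `of_transInv`, `of_dvd` (blocks of side `n ∣ s`), `shift_left/right`, `rowBound_of_summable`); `RowBound K B`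
    (`ℓ^∞ → ℓ^∞` norm, with `abs_le`, `tsum_abs_imageShift_le`); `Decay₂ K C δ` (`|K(x,y)| ≤ C e^{−δ|x−y|₁}`, with
    `decay510_baseFun`, `rowBound`, `summable_row`); `kdelta`, `compKer T S = Σ'_y T(·,y) S(y,·)`.
§2  PERIODISATION `periodise₂ s K x y := Σ'_n K(x̂, ŷ + s·n)` over `(ℤ/s)^d`: `hasSum_periodise₂`,
    `hasSum_periodise₂_of_rep` / `periodise₂_eq_tsum_of_rep` (REPRESENTATIVE INDEPENDENCE for jointly periodic `K`),
    `periodise₂_kdelta` (`δ̂ = 1`), `periodise₂_add`, `periodise₂_const_mul`, `abs_periodise₂_le`.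
§3  THE BLOCK-PERIODIC LEMMA 2.2.2.  `periodise₂_compKer` (PRODUCT RULE `(T∘S)^ = T̂·Ŝ`: Fubini + regrouping by classes);
    `lemma222_periodic` (`T̂ Ŝ = 1 ∧ Ŝ T̂ = 1` from: rows of `T` absolutely summable, `S` jointly periodic with a row
    bound, `T ∘ S = δ` — FEWER hypotheses than print: one-sidedness suffices by finite-dimensionality);
    `eq_periodise₂_of_mul_eq_one(')` (ANY right/left inverse of `T̂` on the torus equals `Ŝ`: the torus Green's function
    IS the image sum of the `ℤ^d` Green's function, however it was constructed); `IsPeriodic₂.of_inverse` (a two-sided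
    row-bounded inverse of a jointly periodic row-bounded `T` is jointly periodic — the printed proof's first sentence).
§4  ENTRYWISE VOLUME LIMITS.  `baseFun S b = (w ↦ S(b+w, b))`, `baseFamily side G b = (x ↦ G_t([b]+x, [b]))` (the
    (R13-3) BASE-POINT reading); `isImageSum_baseFamily_periodise₂` (THE BRIDGE: the displacement family of `Ŝ_t` at any
    base point is an `IsImageSum` of `baseFun S b` — so the whole rate calculus of `VolumeImages` / `VolumeAffine` /
    `VolumeConvolution` applies per base point); `scalarVolumeRate_periodise₂` (rate `C·imageTail d (δ·side t/4)` at
    `δ/2`, constants FREE of `b`); `ScalarVolumeRate.tendsto_siteOf` (rate ⟹ pointwise limit); `tendsto_periodise₂(')`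
    (`Ŝ_t([x],[y]) → S(x,y)`); `abs_periodise₂_sub_le` (one torus, window form); the TRANSFER
    `abs_le_of_eventually_abs_periodise₂_le`, `le_of_eventually_periodise₂_le`, `le_of_eventually_le_periodise₂`
    (`le_of_tendsto`); and the PACKAGED (ii-a) statements for torus Green's functions `G t` with `T̂_t · G t = 1`:
    `tendsto_torusGreen`, `scalarVolumeRate_torusGreen`, `abs_le_of_torusGreen_bound`.
§5  FINITE-RANGE DICTIONARY.  `HasRange T R`; `periodise₂_eq_nearestImage` (`s > 2R`: exactly one image survives,
    `T̂(x,y) = T(x̂, x̂ − u)`, `u` = window representative of `x − y`); `periodise₂_siteOf_eq` (the SUPPLIER'S CHECK: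
    `T̂([a],[a+v]) = T(a, a+v)` whenever `|v_i| + R < s` — a torus operator given by the same stencil / block formula as
    `T`, blocks of side `n ∣ s`, IS `Matrix.of (periodise₂ s T)` once the torus is wider than the stencil).
§6  NON-VACUITY (`T = S = δ`, `G t = 1`: `tendsto_torusGreen_kdelta`).

LABELLED INPUTS (binders, used only to the left of `→`; NOT facts): the `ℤ^d` Green's function `S` (= `K^∞_n`) with
`compKer T S = kdelta`, `Decay₂ S C δ` (`δ > 0`) and joint `side t`-periodicity (DERIVABLE by `IsPeriodic₂.of_inverse` +
`of_dvd` from a two-sided inverse and `n ∣ side t`) — on route P1-K a kernel object of an2 / pv23 / an5, else an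
(α)-leaf; and the identification of the consumer's torus operator with `Matrix.of (periodise₂ (side t) T)` (§5 reduces it
to a stencil check).  CARRIER: cubic tori `(ℤ/s)^d` (the (R13-1) VOLUME CONVENTION «even cubic periods»; evenness plays no
role here; direction-dependent periods `L_μ` of B12's `T_η` are NOT covered — cell DIVERGENCE, as in every `Beta/Volume*`
module).  ABSOLUTE RULE (cell, verbatim): no internally-minted statement may enter as a cited fact; every hypothesis is
either kernel-proved in this package or a verbatim quotation of a PUBLISHED theorem with page reference; the manuscripts
under audit are NOT citable for their own disputed steps — there are NO cited facts in this file (`[cite: …]` tags are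
provenance / context locators).  Companion prose: `run/shared/lean/pub/pub-balaban/BETA/ENTRYWISE-VOLUME-LIMIT.md`;
GAPS row C-an4-21.
-/

namespace Literature.MathematicalPhysics.QuantumFieldTheory.Balaban1983to89.Beta

open Literature.MathematicalPhysics.QuantumFieldTheory.Balaban1983to89
open Literature.MathematicalPhysics.QuantumFieldTheory.Balaban1983to89.B12Sec2to5 (l1 l1_nonneg abs_coord_le_l1 Decay510
  summable_exp_neg_l1)
open _root_.Filter
open scoped _root_.Topology

/-! ## §1. Two-variable kernels on `ℤ^d`: block periodicity, row bounds, two-variable decay -/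

section Kernels

variable {d : ℕ}

/-- Two-variable kernels `K(x, y)`, `x, y ∈ ℤ^d`: operators on `ℤ^d` written by their matrix entries. [folklore] -/
abbrev Kernel₂ (d : ℕ) : Type := (Fin d → ℤ) → (Fin d → ℤ) → ℝ

/-- JOINT `s·ℤ^d`-PERIODICITY (block periodicity): `K(x + s·n, y + s·n) = K(x, y)` for all `n ∈ ℤ^d` — the covariance of a
one-shot block operator (blocks of side `n ∣ s`) under the translations that preserve the block structure; strictly weaker
than translation invariance `K(x + v, y + v) = K(x, y)`. [folklore] -/
def IsPeriodic₂ (s : ℕ) (K : Kernel₂ d) : Prop :=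
  ∀ x y n : Fin d → ℤ, K (imageShift s x n) (imageShift s y n) = K x y

/-- UNIFORM `ℓ¹` ROW BOUND: every row of `K` is absolutely summable with sum `≤ B` (`K : ℓ^∞(ℤ^d) → ℓ^∞(ℤ^d)` with norm
`≤ B`). [folklore] -/
def RowBound (K : Kernel₂ d) (B : ℝ) : Prop :=
  ∀ x, (Summable fun y => |K x y|) ∧ ∑' y, |K x y| ≤ B

/-- TWO-VARIABLE EXPONENTIAL DECAY `|K(x, y)| ≤ C e^{−δ|x − y|₁}` (the (5.10)-shape, off-diagonal). [folklore] -/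
def Decay₂ (K : Kernel₂ d) (C δ : ℝ) : Prop :=
  ∀ x y, |K x y| ≤ C * Real.exp (-δ * l1 (x - y))

/-- The Kronecker kernel `δ(x, y)`. [folklore] -/
def kdelta : Kernel₂ d := fun x y => if x = y then 1 else 0

/-- Composition of kernels (operator product) `(T ∘ S)(x, z) = Σ'_y T(x, y) S(y, z)` as a `tsum`. [folklore] -/
noncomputable def compKer (T S : Kernel₂ d) : Kernel₂ d := fun x z => ∑' y, T x y * S y z

/-- `|−x|₁ = |x|₁`. [folklore] -/
theorem l1_neg (x : Fin d → ℤ) : l1 (-x) = l1 x := by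
  unfold l1
  exact Finset.sum_congr rfl fun μ _ => by simp [abs_neg]

/-- `|x − y|₁ = |y − x|₁`. [folklore] -/
theorem l1_sub_comm (x y : Fin d → ℤ) : l1 (x - y) = l1 (y - x) := by
  rw [← neg_sub, l1_neg]

/-- The image map `n ↦ w + s·n` is injective (`s ≠ 0`). [folklore] -/
theorem imageShift_injective (s : ℕ) [NeZero s] (w : Fin d → ℤ) : Function.Injective (imageShift s w) := by
  intro m m' h
  funext i
  have hi := congrFun h i
  simp only [imageShift_apply] at hi
  have hs : (s : ℤ) ≠ 0 := by exact_mod_cast NeZero.ne s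
  exact mul_left_cancel₀ hs (by linarith)

/-- `b + (w + s·n) = (b + w) + s·n`. [folklore] -/
theorem add_imageShift (s : ℕ) (b w n : Fin d → ℤ) : b + imageShift s w n = imageShift s (b + w) n := by
  funext i; simp only [Pi.add_apply, imageShift_apply]; ring

/-- `(x + s·n) − (y + s·n) = x − y`. [folklore] -/
theorem imageShift_sub_imageShift (s : ℕ) (x y n : Fin d → ℤ) :
    imageShift s x n - imageShift s y n = x - y := by
  funext i; simp only [Pi.sub_apply, imageShift_apply]; ring

/-- The map `w ↦ w + s·n` is injective. [folklore] -/
theorem imageShift_left_injective (s : ℕ) (n : Fin d → ℤ) :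
    Function.Injective (fun w : Fin d → ℤ => imageShift s w n) := by
  intro a c h
  have e := imageShift_sub_imageShift s a c n
  have h' : imageShift s a n = imageShift s c n := h
  rw [h', sub_self] at e
  exact sub_eq_zero.mp e.symm

/-- Translation by the period vector `s·m` as a self-equivalence of `ℤ^d`. [folklore] -/
def imageShiftEquiv (s : ℕ) (m : Fin d → ℤ) : (Fin d → ℤ) ≃ (Fin d → ℤ) :=
  Equiv.addRight (fun i => (s : ℤ) * m i)

/-- `imageShiftEquiv s m` acts as `y ↦ y + s·m`. [folklore] -/
@[simp] theorem imageShiftEquiv_apply (s : ℕ) (m y : Fin d → ℤ) : imageShiftEquiv s m y = imageShift s y m := rfl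

namespace IsPeriodic₂

variable {s : ℕ} {K : Kernel₂ d}

/-- Translation-invariant kernels are block-periodic for every period. [folklore] -/
theorem of_transInv (h : ∀ x y v : Fin d → ℤ, K (x + v) (y + v) = K x y) (s : ℕ) : IsPeriodic₂ s K := by
  intro x y n
  have e : ∀ z : Fin d → ℤ, imageShift s z n = z + fun i => (s : ℤ) * n i := fun z => funext fun i => rfl
  rw [e, e]
  exact h x y _

/-- `n`-periodicity implies `s`-periodicity for `n ∣ s` (the torus sides are multiples of the block side). [folklore] -/
theorem of_dvd {n : ℕ} (h : IsPeriodic₂ n K) (hdvd : n ∣ s) : IsPeriodic₂ s K := by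
  obtain ⟨q, rfl⟩ := hdvd
  intro x y m
  have e : ∀ z : Fin d → ℤ, imageShift (n * q) z m = imageShift n z (fun i => (q : ℤ) * m i) := fun z =>
    funext fun i => by simp only [imageShift_apply, Nat.cast_mul]; ring
  rw [e, e]
  exact h x y _

/-- Moving a period shift from the second to the first variable. [folklore] -/
theorem shift_right (h : IsPeriodic₂ s K) (x y n : Fin d → ℤ) :
    K x (imageShift s y n) = K (imageShift s x (-n)) y := by
  have e := h (imageShift s x (-n)) y n
  rw [imageShift_add, neg_add_cancel, imageShift_zero] at e
  exact e

/-- Moving a period shift from the first to the second variable. [folklore] -/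
theorem shift_left (h : IsPeriodic₂ s K) (x y n : Fin d → ℤ) :
    K (imageShift s x n) y = K x (imageShift s y (-n)) := by
  have e := h x (imageShift s y (-n)) n
  rw [imageShift_add, neg_add_cancel, imageShift_zero] at e
  exact e

/-- A block-periodic kernel with absolutely summable rows has a UNIFORM row bound: the `ℓ¹` norm of a row depends only on
its class modulo `s·ℤ^d`, of which there are finitely many. [folklore] -/
theorem rowBound_of_summable [NeZero s] (h : IsPeriodic₂ s K) (hrow : ∀ x, Summable fun y => |K x y|) :
    RowBound K (∑ c : Site d s, ∑' y, |K (windowMap d s c) y|) := by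
  intro x
  refine ⟨hrow x, ?_⟩
  obtain ⟨p, hp⟩ := exists_eq_imageShift_of_siteOf_eq (rfl : siteOf d s x = siteOf d s x)
  have e : ∑' y, |K x y| = ∑' y, |K (windowMap d s (siteOf d s x)) y| := by
    calc ∑' y, |K x y| = ∑' y, |K (windowMap d s (siteOf d s x)) (imageShiftEquiv s (-p) y)| := by
          refine tsum_congr fun y => ?_
          rw [imageShiftEquiv_apply, ← h.shift_left, ← hp]
      _ = ∑' y, |K (windowMap d s (siteOf d s x)) y| :=
          Equiv.tsum_eq (imageShiftEquiv s (-p)) (fun y => |K (windowMap d s (siteOf d s x)) y|)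
  rw [e]
  exact Finset.single_le_sum (f := fun c : Site d s => ∑' y, |K (windowMap d s c) y|)
    (fun c _ => tsum_nonneg fun y => abs_nonneg _) (Finset.mem_univ _)

end IsPeriodic₂

namespace RowBound

variable {K : Kernel₂ d} {B : ℝ}

/-- The rows are absolutely summable. [folklore] -/
theorem summable_abs (h : RowBound K B) (x : Fin d → ℤ) : Summable fun y => |K x y| := (h x).1

/-- The rows are summable. [folklore] -/
theorem summable (h : RowBound K B) (x : Fin d → ℤ) : Summable (K x) := (h x).1.of_abs

/-- `0 ≤ B`. [folklore] -/
theorem nonneg (h : RowBound K B) : 0 ≤ B := (tsum_nonneg fun y => abs_nonneg (K 0 y)).trans (h 0).2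

/-- Every entry is bounded by the row bound. [folklore] -/
theorem abs_le (h : RowBound K B) (x y : Fin d → ℤ) : |K x y| ≤ B :=
  ((h x).1.le_tsum y fun _ _ => abs_nonneg _).trans (h x).2

/-- Sub-sums of a row over the images of a point are bounded by the row bound. [folklore] -/
theorem tsum_abs_imageShift_le {s : ℕ} [NeZero s] (h : RowBound K B) (x w : Fin d → ℤ) :
    ∑' n, |K x (imageShift s w n)| ≤ B := by
  have h1 : Summable fun n => |K x (imageShift s w n)| := (h x).1.comp_injective (imageShift_injective s w)
  have h2 : ∑' n, |K x (imageShift s w n)| ≤ ∑' y, |K x y| :=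
    Summable.tsum_le_tsum_of_inj (f := fun n => |K x (imageShift s w n)|) (g := fun y => |K x y|)
      (imageShift s w) (imageShift_injective s w) (fun c _ => abs_nonneg (K x c))
      (fun n => le_refl (|K x (imageShift s w n)|)) h1 (h x).1
  exact h2.trans (h x).2

end RowBound

namespace Decay₂

variable {K : Kernel₂ d} {C δ : ℝ}

/-- The constant of a two-variable decay bound is `≥ 0` (read it on the diagonal). [folklore] -/
theorem constant_nonneg (h : Decay₂ K C δ) : 0 ≤ C := by
  have e := h 0 0
  simp only [sub_self] at e
  have : l1 (0 : Fin d → ℤ) = 0 := by simp [l1]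
  rw [this, mul_zero, Real.exp_zero, mul_one] at e
  exact (abs_nonneg _).trans e

/-- AT A BASE POINT `b`, the displacement function `w ↦ K(b + w, b)` obeys (5.10) with the SAME `(C, δ)` — uniformly in
`b`. [folklore] -/
theorem decay510_baseFun (h : Decay₂ K C δ) (b : Fin d → ℤ) : Decay510 (fun w => K (b + w) b) C δ := fun w => by
  simpa [add_sub_cancel_left] using h (b + w) b

/-- Two-variable decay with `δ > 0` gives a uniform row bound `C · Σ_{w ∈ ℤ^d} e^{−δ|w|₁}`. [folklore] -/
theorem rowBound (h : Decay₂ K C δ) (hδ : 0 < δ) : RowBound K (C * ∑' w : Fin d → ℤ, Real.exp (-δ * l1 w)) := by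
  intro x
  have hg : HasSum (fun y : Fin d → ℤ => C * Real.exp (-δ * l1 (x - y)))
      (C * ∑' w : Fin d → ℤ, Real.exp (-δ * l1 w)) := by
    have h1 : HasSum (fun w : Fin d → ℤ => C * Real.exp (-δ * l1 w)) (C * ∑' w : Fin d → ℤ, Real.exp (-δ * l1 w)) :=
      (summable_exp_neg_l1 hδ d).hasSum.mul_left C
    have e : (fun y : Fin d → ℤ => C * Real.exp (-δ * l1 (x - y))) =
        (fun w : Fin d → ℤ => C * Real.exp (-δ * l1 w)) ∘ (Equiv.subLeft x) := by
      funext y; simp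
    rw [e, Equiv.hasSum_iff]
    exact h1
  have hs : Summable fun y => |K x y| := Summable.of_nonneg_of_le (fun _ => abs_nonneg _) (h x) hg.summable
  exact ⟨hs, hasSum_le (h x) hs.hasSum hg⟩

/-- The rows are summable. [folklore] -/
theorem summable_row (h : Decay₂ K C δ) (hδ : 0 < δ) (x : Fin d → ℤ) : Summable (K x) := (h.rowBound hδ).summable x

end Decay₂

end Kernels

/-! ## §2. Two-variable periodisation: the torus matrix of a block-periodic `ℤ^d` operator -/

section Periodise

variable {d : ℕ} {s : ℕ} [NeZero s]

/-- **TWO-VARIABLE PERIODISATION** `K̂(x, y) := Σ_{n ∈ ℤ^d} K(x̂, ŷ + s·n)` over the torus `(ℤ/s)^d` (`x̂, ŷ` the window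
representatives): the torus matrix of the `ℤ^d` operator `K` ("relating G on the torus to G on the whole lattice in the
usual way").  For jointly `s·ℤ^d`-periodic `K` it does not depend on the representatives (`hasSum_periodise₂_of_rep`).
[cite: Slade2017, §2.2.3 Lemma 2.2.2 ("T̂_{x,y} = Σ_{y'~y} T_{x,y'}"), translation-invariant case] -/
noncomputable def periodise₂ (s : ℕ) [NeZero s] (K : Kernel₂ d) (x y : Site d s) : ℝ :=
  ∑' n : Fin d → ℤ, K (windowMap d s x) (imageShift s (windowMap d s y) n)

variable {K : Kernel₂ d}

/-- Row sub-sums over images converge. [folklore] -/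
theorem summable_row_imageShift (hrow : ∀ x, Summable (K x)) (x w : Fin d → ℤ) :
    Summable fun n => K x (imageShift s w n) :=
  (hrow x).comp_injective (imageShift_injective s w)

/-- The defining series of `periodise₂` converges. [folklore] -/
theorem hasSum_periodise₂ (hrow : ∀ x, Summable (K x)) (x y : Site d s) :
    HasSum (fun n => K (windowMap d s x) (imageShift s (windowMap d s y) n)) (periodise₂ s K x y) :=
  (summable_row_imageShift hrow _ _).hasSum

/-- REPRESENTATIVE INDEPENDENCE: for jointly periodic `K`, the image series over ANY representatives `r` of `x` and `q` of
`y` converges to `periodise₂ s K x y`. [folklore] -/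
theorem hasSum_periodise₂_of_rep (hK : IsPeriodic₂ s K) (hrow : ∀ x, Summable (K x)) {x y : Site d s}
    {r q : Fin d → ℤ} (hr : siteOf d s r = x) (hq : siteOf d s q = y) :
    HasSum (fun n => K r (imageShift s q n)) (periodise₂ s K x y) := by
  obtain ⟨p, rfl⟩ := exists_eq_imageShift_of_siteOf_eq hr
  obtain ⟨p', rfl⟩ := exists_eq_imageShift_of_siteOf_eq hq
  have e : (fun n => K (imageShift s (windowMap d s x) p) (imageShift s (imageShift s (windowMap d s y) p') n)) =
      (fun m => K (windowMap d s x) (imageShift s (windowMap d s y) m)) ∘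
        ((Equiv.addLeft p').trans (Equiv.subRight p)) := by
    funext n
    have h1 := hK (windowMap d s x) (imageShift s (windowMap d s y) (p' + n - p)) p
    rw [imageShift_add, sub_add_cancel] at h1
    simpa [imageShift_add] using h1
  rw [e, Equiv.hasSum_iff]
  exact hasSum_periodise₂ hrow x y

/-- `periodise₂` computed with any representatives. [folklore] -/
theorem periodise₂_eq_tsum_of_rep (hK : IsPeriodic₂ s K) (hrow : ∀ x, Summable (K x)) {x y : Site d s}
    {r q : Fin d → ℤ} (hr : siteOf d s r = x) (hq : siteOf d s q = y) :
    periodise₂ s K x y = ∑' n, K r (imageShift s q n) :=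
  (hasSum_periodise₂_of_rep hK hrow hr hq).tsum_eq.symm

/-- The periodisation of the Kronecker kernel of `ℤ^d` is the Kronecker kernel of the torus. [folklore] -/
theorem periodise₂_kdelta (x y : Site d s) : periodise₂ s (kdelta (d := d)) x y = if x = y then 1 else 0 := by
  unfold periodise₂ kdelta
  rw [tsum_eq_single 0]
  · rw [imageShift_zero]
    by_cases hxy : x = y
    · rw [if_pos hxy, if_pos (congrArg _ hxy)]
    · rw [if_neg hxy, if_neg (fun h => hxy (windowMap_injective d s h))]
  · intro n hn
    rw [if_neg]
    intro h
    have hc := congrArg (siteOf d s) h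
    rw [siteOf_windowMap, siteOf_imageShift, siteOf_windowMap] at hc
    subst hc
    exact hn (imageShift_injective s _ ((imageShift_zero s _).trans h)).symm

/-- Additivity of periodisation. [folklore] -/
theorem periodise₂_add {T S : Kernel₂ d} (hT : ∀ x, Summable (T x)) (hS : ∀ x, Summable (S x)) (x y : Site d s) :
    periodise₂ s (T + S) x y = periodise₂ s T x y + periodise₂ s S x y := by
  unfold periodise₂
  simp only [Pi.add_apply]
  exact Summable.tsum_add (summable_row_imageShift hT _ _) (summable_row_imageShift hS _ _)

/-- Homogeneity of periodisation. [folklore] -/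
theorem periodise₂_const_mul (c : ℝ) (K : Kernel₂ d) (x y : Site d s) :
    periodise₂ s (fun a b => c * K a b) x y = c * periodise₂ s K x y := by
  unfold periodise₂
  exact tsum_mul_left

/-- Entries of the periodisation are bounded by the row bound. [folklore] -/
theorem abs_periodise₂_le {B : ℝ} (hKB : RowBound K B) (x y : Site d s) : |periodise₂ s K x y| ≤ B := by
  have h1 : Summable fun n => |K (windowMap d s x) (imageShift s (windowMap d s y) n)| :=
    (hKB.summable_abs _).comp_injective (imageShift_injective s _)
  have h2 := tsum_of_norm_bounded h1.hasSum (fun n => (Real.norm_eq_abs _).le)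
  rw [Real.norm_eq_abs] at h2
  exact h2.trans (hKB.tsum_abs_imageShift_le _ _)

/-! ## §3. The periodic Lemma 2.2.2: the torus inverse IS the periodisation of the `ℤ^d` inverse -/

/-- **PRODUCT RULE.**  If the rows of `T` are absolutely summable and `S` is jointly `s·ℤ^d`-periodic with a uniform row
bound, then `(T ∘ S)^ = T̂ · Ŝ` as matrices over the torus: `Σ_n Σ_y T(x̂,y) S(y, ẑ + sn) = Σ_{c} T̂(x,c) Ŝ(c,z)` (Fubini,
then regroup `y` by classes modulo `s·ℤ^d` and use representative independence for `S`). [cite: Slade2017, Lemma 2.2.2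
(proof: "Σ_{y∈Λ} T̂_{x,y} Ŝ_{y,z} = Σ_{y∈Λ}Σ_{y'~y} T_{x,y'} Σ_{z''~z} T⁻¹_{y',z''}"), translation-invariant case] -/
theorem periodise₂_compKer {T S : Kernel₂ d} {B : ℝ} (hT : ∀ x, Summable fun y => |T x y|) (hS : IsPeriodic₂ s S)
    (hSB : RowBound S B) (x z : Site d s) :
    periodise₂ s (compKer T S) x z = ∑ c : Site d s, periodise₂ s T x c * periodise₂ s S c z := by
  have hSrow : ∀ y, Summable (S y) := hSB.summable
  -- (a) absolute summability of the double family `(y, n) ↦ T(x̂, y) S(y, ẑ + s n)`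
  have hnn : 0 ≤ fun p : (Fin d → ℤ) × (Fin d → ℤ) =>
      |T (windowMap d s x) p.1| * |S p.1 (imageShift s (windowMap d s z) p.2)| :=
    fun p => mul_nonneg (abs_nonneg _) (abs_nonneg _)
  have h2 : Summable fun p : (Fin d → ℤ) × (Fin d → ℤ) =>
      |T (windowMap d s x) p.1| * |S p.1 (imageShift s (windowMap d s z) p.2)| := by
    refine (summable_prod_of_nonneg hnn).mpr ⟨fun y => ?_, ?_⟩
    · show Summable fun n => |T (windowMap d s x) y| * |S y (imageShift s (windowMap d s z) n)|
      have h5 : Summable fun n => |S y (imageShift s (windowMap d s z) n)| :=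
        (hSB.summable_abs y).comp_injective (imageShift_injective s _)
      exact h5.mul_left _
    · refine Summable.of_nonneg_of_le (f := fun y => |T (windowMap d s x) y| * B)
        (fun y => tsum_nonneg fun n => hnn (y, n)) (fun y => ?_) ((hT (windowMap d s x)).mul_right B)
      show ∑' n, |T (windowMap d s x) y| * |S y (imageShift s (windowMap d s z) n)| ≤ |T (windowMap d s x) y| * B
      rw [tsum_mul_left]
      exact mul_le_mul_of_nonneg_left (hSB.tsum_abs_imageShift_le _ _) (abs_nonneg _)
  have h3 : Summable fun p : (Fin d → ℤ) × (Fin d → ℤ) =>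
      |T (windowMap d s x) p.1 * S p.1 (imageShift s (windowMap d s z) p.2)| := by
    simpa only [abs_mul] using h2
  have hf : Summable (Function.uncurry fun (y : Fin d → ℤ) (n : Fin d → ℤ) =>
      T (windowMap d s x) y * S y (imageShift s (windowMap d s z) n)) := h3.of_abs
  -- (b) summability of `y ↦ T(x̂, y) Ŝ(siteOf y, z)`
  have hφ : Summable fun y => T (windowMap d s x) y * periodise₂ s S (siteOf d s y) z :=
    Summable.of_norm_bounded ((hT _).mul_right B) fun y => by
      rw [Real.norm_eq_abs, abs_mul]
      exact mul_le_mul_of_nonneg_left (abs_periodise₂_le hSB _ _) (abs_nonneg _)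
  calc periodise₂ s (compKer T S) x z
      = ∑' n, ∑' y, T (windowMap d s x) y * S y (imageShift s (windowMap d s z) n) := rfl
    _ = ∑' y, ∑' n, T (windowMap d s x) y * S y (imageShift s (windowMap d s z) n) := hf.tsum_comm
    _ = ∑' y, T (windowMap d s x) y * periodise₂ s S (siteOf d s y) z := by
        refine tsum_congr fun y => ?_
        rw [tsum_mul_left, (hasSum_periodise₂_of_rep hS hSrow rfl (siteOf_windowMap d s z)).tsum_eq]
    _ = ∑ c : Site d s, ∑' m, T (windowMap d s x) (imageShift s (windowMap d s c) m) *
          periodise₂ s S (siteOf d s (imageShift s (windowMap d s c) m)) z :=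
        tsum_eq_sum_tsum_imageShift hφ
    _ = ∑ c : Site d s, periodise₂ s T x c * periodise₂ s S c z := by
        refine Finset.sum_congr rfl fun c _ => ?_
        simp only [siteOf_imageShift, siteOf_windowMap]
        rw [tsum_mul_right]
        rfl

/-- **LEMMA 2.2.2, BLOCK-PERIODIC VERSION.**  If `T` has absolutely summable rows and a right inverse `S` on `ℤ^d`
(`T ∘ S = δ`) which is jointly `s·ℤ^d`-periodic with a uniform row bound, then on the torus `(ℤ/s)^d` the periodised
matrices are inverse to each other ON BOTH SIDES: `T̂ Ŝ = 1` and `Ŝ T̂ = 1` (the second by finite-dimensionality).  Print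
(Slade) assumes full translation invariance of `T`; the proof is the same for block periodicity, which is all a one-shot
block operator has. [cite: Slade2017, Lemma 2.2.2 (arXiv:1611.06169 §2.2.3), translation-invariant case] -/
theorem lemma222_periodic {T S : Kernel₂ d} {B : ℝ} (hT : ∀ x, Summable fun y => |T x y|) (hS : IsPeriodic₂ s S)
    (hSB : RowBound S B) (hTS : compKer T S = kdelta) :
    Matrix.of (periodise₂ s T) * Matrix.of (periodise₂ s S) = 1 ∧
      Matrix.of (periodise₂ s S) * Matrix.of (periodise₂ s T) = 1 := by
  have h1 : Matrix.of (periodise₂ s T) * Matrix.of (periodise₂ s S) = 1 := by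
    ext x z
    rw [Matrix.mul_apply, Matrix.one_apply]
    simp only [Matrix.of_apply]
    rw [← periodise₂_compKer hT hS hSB, hTS, periodise₂_kdelta]
  exact ⟨h1, mul_eq_one_comm.mp h1⟩

/-- **IDENTIFICATION OF THE TORUS GREEN'S FUNCTION.**  Under the hypotheses of `lemma222_periodic`, ANY right inverse `G`
of the torus matrix `T̂` equals `Ŝ`: the torus Green's function is the periodisation (image sum) of the `ℤ^d` Green's
function — however `G` was obtained. [folklore] -/
theorem eq_periodise₂_of_mul_eq_one {T S : Kernel₂ d} {B : ℝ} (hT : ∀ x, Summable fun y => |T x y|)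
    (hS : IsPeriodic₂ s S) (hSB : RowBound S B) (hTS : compKer T S = kdelta)
    {G : Matrix (Site d s) (Site d s) ℝ} (hG : Matrix.of (periodise₂ s T) * G = 1) :
    G = Matrix.of (periodise₂ s S) := by
  have h2 := (lemma222_periodic hT hS hSB hTS).2
  calc G = (Matrix.of (periodise₂ s S) * Matrix.of (periodise₂ s T)) * G := by rw [h2, Matrix.one_mul]
    _ = Matrix.of (periodise₂ s S) := by rw [Matrix.mul_assoc, hG, Matrix.mul_one]

/-- The same for a left inverse. [folklore] -/
theorem eq_periodise₂_of_mul_eq_one' {T S : Kernel₂ d} {B : ℝ} (hT : ∀ x, Summable fun y => |T x y|)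
    (hS : IsPeriodic₂ s S) (hSB : RowBound S B) (hTS : compKer T S = kdelta)
    {G : Matrix (Site d s) (Site d s) ℝ} (hG : G * Matrix.of (periodise₂ s T) = 1) :
    G = Matrix.of (periodise₂ s S) := by
  have h1 := (lemma222_periodic hT hS hSB hTS).1
  calc G = G * (Matrix.of (periodise₂ s T) * Matrix.of (periodise₂ s S)) := by rw [h1, Matrix.mul_one]
    _ = Matrix.of (periodise₂ s S) := by rw [← Matrix.mul_assoc, hG, Matrix.one_mul]

omit [NeZero s] in
/-- **THE INVERSE OF A BLOCK-PERIODIC OPERATOR IS BLOCK-PERIODIC** (the first sentence of the printed proof of Lemma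
2.2.2, "The assumed translation invariance for `T` implies the same for `T⁻¹`", in the block-periodic setting): if `T` is
jointly `s·ℤ^d`-periodic with a uniform row bound and `S` is a TWO-SIDED inverse with a uniform row bound, then `S` is
jointly `s·ℤ^d`-periodic (uniqueness of two-sided inverses in the bounded operators on `ℓ^∞`: `S = S T S' = S'` for the
conjugated inverse `S'`). [cite: Slade2017, Lemma 2.2.2 (proof, first sentence), translation-invariant case] -/
theorem IsPeriodic₂.of_inverse {T S : Kernel₂ d} {A B : ℝ} (hT : IsPeriodic₂ s T) (hTA : RowBound T A)
    (hSB : RowBound S B) (hTS : compKer T S = kdelta) (hST : compKer S T = kdelta) : IsPeriodic₂ s S := by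
  intro x z n
  -- the conjugated kernel `S' a b := S (a + s n) (b + s n)` is again a right inverse of `T`
  have hTS' : ∀ a c : Fin d → ℤ, ∑' b, T a b * S (imageShift s b n) (imageShift s c n) = kdelta a c := by
    intro a c
    have e2 : compKer T S (imageShift s a n) (imageShift s c n) = kdelta (imageShift s a n) (imageShift s c n) :=
      congrFun (congrFun hTS (imageShift s a n)) (imageShift s c n)
    calc ∑' b, T a b * S (imageShift s b n) (imageShift s c n)
        = ∑' b, T (imageShift s a n) (imageShiftEquiv s n b) * S (imageShiftEquiv s n b) (imageShift s c n) :=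
          tsum_congr fun b => by rw [imageShiftEquiv_apply, hT a b n]
      _ = ∑' b, T (imageShift s a n) b * S b (imageShift s c n) :=
          (imageShiftEquiv s n).tsum_eq (fun b => T (imageShift s a n) b * S b (imageShift s c n))
      _ = kdelta (imageShift s a n) (imageShift s c n) := e2
      _ = kdelta a c := by
          simp only [kdelta]
          by_cases hac : a = c
          · rw [if_pos hac, if_pos (by rw [hac])]
          · rw [if_neg hac, if_neg (fun h => hac (imageShift_left_injective s n h))]
  -- Fubini data for `(y, w) ↦ S x y · (T y w · S' w z)`
  have hB := hSB.nonneg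
  have hnn : 0 ≤ fun p : (Fin d → ℤ) × (Fin d → ℤ) =>
      |S x p.1| * (|T p.1 p.2| * |S (imageShift s p.2 n) (imageShift s z n)|) :=
    fun p => mul_nonneg (abs_nonneg _) (mul_nonneg (abs_nonneg _) (abs_nonneg _))
  have h2 : Summable fun p : (Fin d → ℤ) × (Fin d → ℤ) =>
      |S x p.1| * (|T p.1 p.2| * |S (imageShift s p.2 n) (imageShift s z n)|) := by
    refine (summable_prod_of_nonneg hnn).mpr ⟨fun y => ?_, ?_⟩
    · show Summable fun w => |S x y| * (|T y w| * |S (imageShift s w n) (imageShift s z n)|)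
      have h4 : Summable fun w => |T y w| * B := (hTA.summable_abs y).mul_right B
      have h5 : Summable fun w => |T y w| * |S (imageShift s w n) (imageShift s z n)| :=
        Summable.of_nonneg_of_le (fun w => mul_nonneg (abs_nonneg _) (abs_nonneg _))
          (fun w => mul_le_mul_of_nonneg_left (hSB.abs_le _ _) (abs_nonneg _)) h4
      exact h5.mul_left _
    · refine Summable.of_nonneg_of_le (f := fun y => |S x y| * (A * B)) (fun y => tsum_nonneg fun w => hnn (y, w))
        (fun y => ?_) ((hSB.summable_abs x).mul_right (A * B))
      show ∑' w, |S x y| * (|T y w| * |S (imageShift s w n) (imageShift s z n)|) ≤ |S x y| * (A * B)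
      rw [tsum_mul_left]
      refine mul_le_mul_of_nonneg_left ?_ (abs_nonneg _)
      have h4 : Summable fun w => |T y w| * B := (hTA.summable_abs y).mul_right B
      calc ∑' w, |T y w| * |S (imageShift s w n) (imageShift s z n)|
          ≤ ∑' w, |T y w| * B := Summable.tsum_le_tsum (fun w => mul_le_mul_of_nonneg_left (hSB.abs_le _ _)
              (abs_nonneg _)) (Summable.of_nonneg_of_le (fun w => mul_nonneg (abs_nonneg _) (abs_nonneg _))
              (fun w => mul_le_mul_of_nonneg_left (hSB.abs_le _ _) (abs_nonneg _)) h4) h4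
        _ = (∑' w, |T y w|) * B := tsum_mul_right
        _ ≤ A * B := mul_le_mul_of_nonneg_right (hTA y).2 hB
  have h3 : Summable fun p : (Fin d → ℤ) × (Fin d → ℤ) =>
      |S x p.1 * (T p.1 p.2 * S (imageShift s p.2 n) (imageShift s z n))| := by
    simpa only [abs_mul] using h2
  have hF : Summable (Function.uncurry fun (y w : Fin d → ℤ) =>
      S x y * (T y w * S (imageShift s w n) (imageShift s z n))) := h3.of_abs
  have hST' : ∀ w, ∑' y, S x y * T y w = kdelta x w := fun w => congrFun (congrFun hST x) w
  symm
  calc S x z = ∑' y, S x y * kdelta y z := by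
        rw [tsum_eq_single z]
        · simp [kdelta]
        · intro y hy; simp [kdelta, hy]
    _ = ∑' y, ∑' w, S x y * (T y w * S (imageShift s w n) (imageShift s z n)) := by
        refine tsum_congr fun y => ?_
        rw [← hTS' y z, tsum_mul_left]
    _ = ∑' w, ∑' y, S x y * (T y w * S (imageShift s w n) (imageShift s z n)) := hF.tsum_comm.symm
    _ = ∑' w, kdelta x w * S (imageShift s w n) (imageShift s z n) := by
        refine tsum_congr fun w => ?_
        rw [← hST' w, ← tsum_mul_right]
        exact tsum_congr fun y => (mul_assoc _ _ _).symm
    _ = S (imageShift s x n) (imageShift s z n) := by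
        rw [tsum_eq_single x]
        · simp [kdelta]
        · intro w hw; simp [kdelta, Ne.symm hw]

end Periodise

/-! ## §4. Entrywise volume limits, per base point, with an explicit rate -/

section VolumeLimit

variable {d : ℕ}

/-- The DISPLACEMENT FUNCTION of a `ℤ^d` kernel at the base point `b`: `w ↦ S(b + w, b)`. [folklore] -/
def baseFun (S : Kernel₂ d) (b : Fin d → ℤ) : (Fin d → ℤ) → ℝ := fun w => S (b + w) b

variable {side : ℕ → ℕ} [∀ t, NeZero (side t)]

/-- The DISPLACEMENT FAMILY at the base point `b` of a family of torus kernels `G t` (tori of sides `side t`):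
`x ↦ G_t([b] + x, [b])`. [folklore] -/
def baseFamily (side : ℕ → ℕ) [∀ t, NeZero (side t)] (G : (t : ℕ) → Site d (side t) → Site d (side t) → ℝ)
    (b : Fin d → ℤ) : (t : ℕ) → Site d (side t) → ℝ :=
  fun t x => G t (siteOf d (side t) b + x) (siteOf d (side t) b)

/-- **THE BRIDGE TO THE METHOD OF IMAGES.**  For a jointly periodic `ℤ^d` kernel `S` with summable rows, the displacement
family at ANY base point `b` of its periodisations is the image sum (`VolumeImages.IsImageSum`) of the displacement
function of `S` at `b`; hence the whole rate calculus of `Beta/VolumeImages`, `VolumeAffine`, `VolumeConvolution` applies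
per base point. [folklore] -/
theorem isImageSum_baseFamily_periodise₂ {S : Kernel₂ d} (hS : ∀ t, IsPeriodic₂ (side t) S)
    (hrow : ∀ x, Summable (S x)) (b : Fin d → ℤ) :
    IsImageSum side (baseFamily side (fun t => periodise₂ (side t) S) b) (baseFun S b) := by
  intro t x
  show HasSum (fun n => S (b + imageShift (side t) (windowMap d (side t) x) n) b)
    (periodise₂ (side t) S (siteOf d (side t) b + x) (siteOf d (side t) b))
  have hr : siteOf d (side t) (b + windowMap d (side t) x) = siteOf d (side t) b + x := by
    rw [siteOf_add, siteOf_windowMap]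
  have h0 : HasSum (fun n => S (b + windowMap d (side t) x) (imageShift (side t) b n))
      (periodise₂ (side t) S (siteOf d (side t) b + x) (siteOf d (side t) b)) :=
    hasSum_periodise₂_of_rep (hS t) hrow hr (rfl : siteOf d (side t) b = siteOf d (side t) b)
  have e : (fun n => S (b + imageShift (side t) (windowMap d (side t) x) n) b) =
      (fun n => S (b + windowMap d (side t) x) (imageShift (side t) b n)) ∘ (Equiv.neg (Fin d → ℤ)) := by
    funext n
    simp only [Function.comp_apply, Equiv.neg_apply]
    rw [(hS t).shift_right, neg_neg, add_imageShift]
  rw [e, Equiv.hasSum_iff]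
  exact h0

/-- **ENTRYWISE VOLUME RATE, per base point, constants free of the base point.**  For `S` jointly `side t`-periodic for
every `t` and `(C, δ)`-decaying with `δ > 0`: at every base point `b`,
`|Ŝ_t([b] + x, [b]) − S(b + x̂, b)| ≤ C · imageTail d (δ·side t/4) · e^{−(δ/2)|x̂|₁}`. [folklore] -/
theorem scalarVolumeRate_periodise₂ {S : Kernel₂ d} {C δ : ℝ} (hS : ∀ t, IsPeriodic₂ (side t) S)
    (hdec : Decay₂ S C δ) (hδ : 0 < δ) (b : Fin d → ℤ) :
    ScalarVolumeRate side (baseFamily side (fun t => periodise₂ (side t) S) b) (baseFun S b)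
      (fun t => C * imageTail d (δ * side t / 4)) (δ / 2) :=
  (isImageSum_baseFamily_periodise₂ hS (hdec.summable_row hδ) b).scalarVolumeRate (hdec.decay510_baseFun b) hδ

omit [∀ t, NeZero (side t)] in
/-- A scalar volume rate with `ρ t → 0` along growing sides gives the POINTWISE LIMIT at every fixed displacement `w`
(eventually `w` is in the window, where the rate bound reads `|F t [w] − Finf w| ≤ ρ t`). [folklore] -/
theorem ScalarVolumeRate.tendsto_siteOf [∀ t, NeZero (side t)] {F : (t : ℕ) → Site d (side t) → ℝ}
    {Finf : (Fin d → ℤ) → ℝ} {ρ : ℕ → ℝ} {δ' : ℝ} (h : ScalarVolumeRate side F Finf ρ δ') (hδ' : 0 ≤ δ')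
    (hρ : Tendsto ρ atTop (𝓝 0)) (hside : Tendsto side atTop atTop) (w : Fin d → ℤ) :
    Tendsto (fun t => F t (siteOf d (side t) w)) atTop (𝓝 (Finf w)) := by
  rw [← tendsto_sub_nhds_zero_iff]
  refine squeeze_zero_norm' ?_ hρ
  filter_upwards [eventually_inWindow hside w] with t ht
  rw [Real.norm_eq_abs]
  have key := h t (siteOf d (side t) w)
  rw [windowMap_siteOf d (side t) ht] at key
  have h1 : Real.exp (-δ' * l1 w) ≤ 1 := by
    rw [Real.exp_le_one_iff]
    have := mul_nonneg hδ' (l1_nonneg w)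
    linarith
  calc |F t (siteOf d (side t) w) - Finf w| ≤ ρ t * Real.exp (-δ' * l1 w) := key
    _ ≤ ρ t * 1 := mul_le_mul_of_nonneg_left h1 (h.nonneg t)
    _ = ρ t := mul_one _

/-- **ENTRYWISE VOLUME LIMIT of the periodisations**: `Ŝ_t([b + w], [b]) → S(b + w, b)` as `side t → ∞`, for every base
point `b` and displacement `w`. [folklore] -/
theorem tendsto_periodise₂ {S : Kernel₂ d} {C δ : ℝ} (hS : ∀ t, IsPeriodic₂ (side t) S) (hdec : Decay₂ S C δ)
    (hδ : 0 < δ) (hside : Tendsto side atTop atTop) (b w : Fin d → ℤ) :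
    Tendsto (fun t => periodise₂ (side t) S (siteOf d (side t) (b + w)) (siteOf d (side t) b)) atTop
      (𝓝 (S (b + w) b)) := by
  have h := (scalarVolumeRate_periodise₂ hS hdec hδ b).tendsto_siteOf (half_pos hδ).le
    (tendsto_imageTail_side hδ hside d C) hside w
  simpa [baseFamily, baseFun, siteOf_add] using h

/-- The same in two-point form: `Ŝ_t([x], [y]) → S(x, y)`. [folklore] -/
theorem tendsto_periodise₂' {S : Kernel₂ d} {C δ : ℝ} (hS : ∀ t, IsPeriodic₂ (side t) S) (hdec : Decay₂ S C δ)
    (hδ : 0 < δ) (hside : Tendsto side atTop atTop) (x y : Fin d → ℤ) :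
    Tendsto (fun t => periodise₂ (side t) S (siteOf d (side t) x) (siteOf d (side t) y)) atTop (𝓝 (S x y)) := by
  have h := tendsto_periodise₂ hS hdec hδ hside y (x - y)
  simpa [add_sub_cancel] using h

/-- **THE EXPLICIT ENTRYWISE BOUND ON ONE TORUS** (no limit): for `w` in the window of the torus of side `s`,
`|Ŝ([b + w], [b]) − S(b + w, b)| ≤ C · imageTail d (δs/4) · e^{−(δ/2)|w|₁}`, constants free of `b`. [folklore] -/
theorem abs_periodise₂_sub_le {s : ℕ} [NeZero s] {S : Kernel₂ d} {C δ : ℝ} (hS : IsPeriodic₂ s S)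
    (hdec : Decay₂ S C δ) (hδ : 0 < δ) (b w : Fin d → ℤ) (hw : ∀ i, InWindow s (w i)) :
    |periodise₂ s S (siteOf d s (b + w)) (siteOf d s b) - S (b + w) b| ≤
      C * imageTail d (δ * s / 4) * Real.exp (-(δ / 2) * l1 w) := by
  have h := scalarVolumeRate_periodise₂ (side := fun _ => s) (fun _ => hS) hdec hδ b 0 (siteOf d s w)
  simpa [baseFamily, baseFun, windowMap_siteOf d s hw, siteOf_add] using h

/-! ### The transfer «volume-uniform bound ⟹ bound of the limit» -/

/-- **TRANSFER**: an eventual volume-uniform bound on the torus entries passes to the `ℤ^d` entry (`le_of_tendsto`).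
[folklore] -/
theorem abs_le_of_eventually_abs_periodise₂_le {S : Kernel₂ d} {C δ M : ℝ} (hS : ∀ t, IsPeriodic₂ (side t) S)
    (hdec : Decay₂ S C δ) (hδ : 0 < δ) (hside : Tendsto side atTop atTop) (x y : Fin d → ℤ)
    (hM : ∀ᶠ t in atTop, |periodise₂ (side t) S (siteOf d (side t) x) (siteOf d (side t) y)| ≤ M) :
    |S x y| ≤ M :=
  le_of_tendsto (tendsto_periodise₂' hS hdec hδ hside x y).abs hM

/-- One-sided transfer (upper). [folklore] -/
theorem le_of_eventually_periodise₂_le {S : Kernel₂ d} {C δ M : ℝ} (hS : ∀ t, IsPeriodic₂ (side t) S)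
    (hdec : Decay₂ S C δ) (hδ : 0 < δ) (hside : Tendsto side atTop atTop) (x y : Fin d → ℤ)
    (hM : ∀ᶠ t in atTop, periodise₂ (side t) S (siteOf d (side t) x) (siteOf d (side t) y) ≤ M) : S x y ≤ M :=
  le_of_tendsto (tendsto_periodise₂' hS hdec hδ hside x y) hM

/-- One-sided transfer (lower). [folklore] -/
theorem le_of_eventually_le_periodise₂ {S : Kernel₂ d} {C δ M : ℝ} (hS : ∀ t, IsPeriodic₂ (side t) S)
    (hdec : Decay₂ S C δ) (hδ : 0 < δ) (hside : Tendsto side atTop atTop) (x y : Fin d → ℤ)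
    (hM : ∀ᶠ t in atTop, M ≤ periodise₂ (side t) S (siteOf d (side t) x) (siteOf d (side t) y)) : M ≤ S x y :=
  ge_of_tendsto (tendsto_periodise₂' hS hdec hδ hside x y) hM

/-! ### The packaged statement for torus Green's functions -/

/-- **ENTRYWISE VOLUME LIMIT OF TORUS GREEN'S FUNCTIONS (ii-a).**  DATA: a `ℤ^d` operator `T` with absolutely summable
rows (the one-shot block operator, e.g. `−Δ + a Q*Q (+ m²)`), a `ℤ^d` kernel `S` (ITS GREEN'S FUNCTION — the LABELLED
INPUT: `T ∘ S = δ`, jointly `side t`-periodic for every `t`, `(C, δ)`-decaying with `δ > 0`), cubic tori of sides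
`side t → ∞`, and on each torus ANY right inverse `G t` of the torus matrix `T̂_t = periodise₂ (side t) T`.  THEN every
entry converges: `G_t([x], [y]) → S(x, y)`. [folklore] -/
theorem tendsto_torusGreen {T S : Kernel₂ d} {C δ : ℝ} (hT : ∀ x, Summable fun y => |T x y|)
    (hS : ∀ t, IsPeriodic₂ (side t) S) (hdec : Decay₂ S C δ) (hδ : 0 < δ) (hTS : compKer T S = kdelta)
    (hside : Tendsto side atTop atTop) {G : (t : ℕ) → Matrix (Site d (side t)) (Site d (side t)) ℝ}
    (hG : ∀ t, Matrix.of (periodise₂ (side t) T) * G t = 1) (x y : Fin d → ℤ) :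
    Tendsto (fun t => G t (siteOf d (side t) x) (siteOf d (side t) y)) atTop (𝓝 (S x y)) := by
  have e : ∀ t, G t = Matrix.of (periodise₂ (side t) S) := fun t =>
    eq_periodise₂_of_mul_eq_one hT (hS t) (hdec.rowBound hδ) hTS (hG t)
  simp only [e, Matrix.of_apply]
  exact tendsto_periodise₂' hS hdec hδ hside x y

/-- **… WITH THE EXPLICIT RATE, per base point** (constants free of `b` and of the volume history):
`|G_t([b] + x, [b]) − S(b + x̂, b)| ≤ C · imageTail d (δ·side t/4) · e^{−(δ/2)|x̂|₁}`. [folklore] -/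
theorem scalarVolumeRate_torusGreen {T S : Kernel₂ d} {C δ : ℝ} (hT : ∀ x, Summable fun y => |T x y|)
    (hS : ∀ t, IsPeriodic₂ (side t) S) (hdec : Decay₂ S C δ) (hδ : 0 < δ) (hTS : compKer T S = kdelta)
    {G : (t : ℕ) → Matrix (Site d (side t)) (Site d (side t)) ℝ}
    (hG : ∀ t, Matrix.of (periodise₂ (side t) T) * G t = 1) (b : Fin d → ℤ) :
    ScalarVolumeRate side (baseFamily side (fun t x y => G t x y) b) (baseFun S b)
      (fun t => C * imageTail d (δ * side t / 4)) (δ / 2) := by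
  have e : ∀ t, G t = Matrix.of (periodise₂ (side t) S) := fun t =>
    eq_periodise₂_of_mul_eq_one hT (hS t) (hdec.rowBound hδ) hTS (hG t)
  have e' : (fun t x y => G t x y) = fun t => periodise₂ (side t) S := by
    funext t x y; rw [e t]; rfl
  rw [e']
  exact scalarVolumeRate_periodise₂ hS hdec hδ b

/-- **… AND THE TRANSFER**: an eventual volume-uniform bound `|G_t([x], [y])| ≤ M` gives `|S(x, y)| ≤ M`. [folklore] -/
theorem abs_le_of_torusGreen_bound {T S : Kernel₂ d} {C δ M : ℝ} (hT : ∀ x, Summable fun y => |T x y|)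
    (hS : ∀ t, IsPeriodic₂ (side t) S) (hdec : Decay₂ S C δ) (hδ : 0 < δ) (hTS : compKer T S = kdelta)
    (hside : Tendsto side atTop atTop) {G : (t : ℕ) → Matrix (Site d (side t)) (Site d (side t)) ℝ}
    (hG : ∀ t, Matrix.of (periodise₂ (side t) T) * G t = 1) (x y : Fin d → ℤ)
    (hM : ∀ᶠ t in atTop, |G t (siteOf d (side t) x) (siteOf d (side t) y)| ≤ M) : |S x y| ≤ M :=
  le_of_tendsto (tendsto_torusGreen hT hS hdec hδ hTS hside hG x y).abs hM

end VolumeLimit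

/-! ## §5. The dictionary for FINITE-RANGE operators: the torus matrix IS the periodisation -/

section FiniteRange

variable {d : ℕ} {s : ℕ} [NeZero s]

/-- FINITE RANGE `R` (sup metric): `T(x, y) = 0` unless `|x_i − y_i| ≤ R` for every coordinate `i` — the shape of
`−Δ`, of a block-averaging term `a Q*Q` (range `n − 1` for blocks of side `n`), and of any finite-difference operator.
[folklore] -/
def HasRange (T : Kernel₂ d) (R : ℕ) : Prop :=
  ∀ x y, (∃ i, (R : ℤ) < |x i - y i|) → T x y = 0

/-- One coordinate: for `k ≠ 0`, `s − |u| ≤ |u + s·k|`. [folklore] -/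
theorem sub_abs_le_abs_add_mul (s : ℕ) (u : ℤ) {k : ℤ} (hk : k ≠ 0) : (s : ℤ) - |u| ≤ |u + s * k| := by
  have h1 : (1 : ℤ) ≤ |k| := Int.one_le_abs hk
  have h2 : |(s : ℤ) * k| = (s : ℤ) * |k| := by
    rw [abs_mul, abs_of_nonneg (Int.natCast_nonneg s)]
  have h3 : |(s : ℤ) * k| ≤ |u + s * k| + |u| := by
    have e := abs_sub (u + (s : ℤ) * k) u
    rwa [add_sub_cancel_left] at e
  have h4 : (s : ℤ) * 1 ≤ (s : ℤ) * |k| := mul_le_mul_of_nonneg_left h1 (Int.natCast_nonneg s)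
  linarith

/-- **NEAREST-IMAGE FORM.**  For `T` of range `R` and a torus of side `s > 2R`, the periodisation has exactly one
non-zero image: `T̂(x, y) = T(x̂, x̂ − u)` with `u` the window representative of the torus difference `x − y` (the entry of
`T` "read on the torus": the torus neighbour `y` of `x` is seen at the `ℤ^d` displacement `−u`). [folklore] -/
theorem periodise₂_eq_nearestImage {T : Kernel₂ d} {R : ℕ} (hT : HasRange T R) (hs : 2 * R < s) (x y : Site d s) :
    periodise₂ s T x y = T (windowMap d s x) (windowMap d s x - windowMap d s (x - y)) := by
  obtain ⟨n₀, hn₀⟩ : ∃ n₀ : Fin d → ℤ,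
      windowMap d s x - windowMap d s y = imageShift s (windowMap d s (x - y)) n₀ :=
    exists_eq_imageShift_of_siteOf_eq (by rw [siteOf_sub, siteOf_windowMap, siteOf_windowMap])
  have key : windowMap d s x - windowMap d s (x - y) = imageShift s (windowMap d s y) n₀ := by
    funext i
    have e := congrFun hn₀ i
    simp only [Pi.sub_apply, imageShift_apply] at e ⊢
    linarith
  unfold periodise₂
  rw [tsum_eq_single n₀, key]
  intro n hn
  apply hT
  have hne : n₀ - n ≠ 0 := sub_ne_zero.mpr (Ne.symm hn)
  obtain ⟨i, hi⟩ : ∃ i, (n₀ - n) i ≠ 0 := by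
    by_contra h
    exact hne (funext fun i => by simpa using not_exists.mp h i)
  refine ⟨i, ?_⟩
  have e : windowMap d s x i - imageShift s (windowMap d s y) n i =
      windowMap d s (x - y) i + (s : ℤ) * (n₀ - n) i := by
    have e0 := congrFun hn₀ i
    simp only [Pi.sub_apply, imageShift_apply] at e0 ⊢
    linear_combination e0
  rw [e]
  have hu : 2 * |windowMap d s (x - y) i| ≤ (s : ℤ) := two_mul_abs_symmRep_le s ((x - y) i)
  have hs' : (2 * R : ℤ) < s := by exact_mod_cast hs
  have h5 := sub_abs_le_abs_add_mul s (windowMap d s (x - y) i) hi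
  linarith

/-- **LIFT FORM** (the supplier's check): for jointly `s`-periodic `T` of range `R` with summable rows, the torus entry
between the classes of `a` and `a + v` IS the `ℤ^d` entry `T(a, a + v)` whenever `|v_i| + R < s` for all `i` — so a torus
operator defined by the same finite-difference / block formula as `T` (blocks of side `n ∣ s`) coincides with
`Matrix.of (periodise₂ s T)` as soon as the torus is wider than the stencil. [folklore] -/
theorem periodise₂_siteOf_eq {T : Kernel₂ d} {R : ℕ} (hper : IsPeriodic₂ s T) (hrow : ∀ x, Summable (T x))
    (hT : HasRange T R) (a v : Fin d → ℤ) (hv : ∀ i, |v i| + R < s) :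
    periodise₂ s T (siteOf d s a) (siteOf d s (a + v)) = T a (a + v) := by
  rw [periodise₂_eq_tsum_of_rep hper hrow (rfl : siteOf d s a = siteOf d s a)
    (rfl : siteOf d s (a + v) = siteOf d s (a + v)), tsum_eq_single 0]
  · rw [imageShift_zero]
  · intro n hn
    apply hT
    obtain ⟨i, hi⟩ : ∃ i, n i ≠ 0 := by
      by_contra h
      exact hn (funext fun i => by simpa using not_exists.mp h i)
    refine ⟨i, ?_⟩
    have e : a i - imageShift s (a + v) n i = -(v i + (s : ℤ) * n i) := by
      simp only [imageShift_apply, Pi.add_apply]; ring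
    rw [e, abs_neg]
    have h5 := sub_abs_le_abs_add_mul s (v i) hi
    have hv' := hv i
    linarith

end FiniteRange

/-! ## §6. Non-vacuity: the hypotheses of the packaged theorem hold for the identity operator -/

section Witness

variable {d : ℕ}

/-- The Kronecker kernel is jointly periodic for every period. [folklore] -/
theorem isPeriodic₂_kdelta (s : ℕ) : IsPeriodic₂ s (kdelta (d := d)) := by
  intro x y n
  simp only [kdelta]
  by_cases hxy : x = y
  · rw [if_pos hxy, if_pos (by rw [hxy])]
  · rw [if_neg hxy, if_neg (fun h => hxy (imageShift_left_injective s n h))]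

/-- The rows of the Kronecker kernel are absolutely summable. [folklore] -/
theorem summable_abs_kdelta (x : Fin d → ℤ) : Summable fun y => |kdelta (d := d) x y| := by
  refine summable_of_ne_finset_zero (s := {x}) fun y hy => ?_
  rw [Finset.mem_singleton] at hy
  simp [kdelta, Ne.symm hy]

/-- The Kronecker kernel is `(1, δ)`-decaying for every `δ`. [folklore] -/
theorem decay₂_kdelta (δ : ℝ) : Decay₂ (kdelta (d := d)) 1 δ := by
  intro x y
  simp only [kdelta]
  by_cases hxy : x = y
  · subst hxy
    have : l1 (x - x) = 0 := by simp [l1]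
    rw [if_pos rfl, this, mul_zero, Real.exp_zero, mul_one, abs_one]
  · rw [if_neg hxy, abs_zero, one_mul]
    exact (Real.exp_pos _).le

/-- The Kronecker kernel is its own inverse. [folklore] -/
theorem compKer_kdelta_kdelta : compKer (kdelta (d := d)) kdelta = kdelta := by
  funext x z
  simp only [compKer]
  rw [tsum_eq_single x]
  · simp [kdelta]
  · intro y hy
    simp [kdelta, Ne.symm hy]

/-- NON-VACUITY WITNESS: with `T = S = δ` (the identity operator on `ℤ^d`) and `G t = 1` on every torus, all hypotheses
of `tendsto_torusGreen` are met (and its conclusion is the trivial limit `1 → 1`, `0 → 0`). [folklore] -/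
theorem tendsto_torusGreen_kdelta {side : ℕ → ℕ} [∀ t, NeZero (side t)] (hside : Tendsto side atTop atTop)
    (x y : Fin d → ℤ) :
    Tendsto (fun t => (1 : Matrix (Site d (side t)) (Site d (side t)) ℝ) (siteOf d (side t) x) (siteOf d (side t) y))
      atTop (𝓝 (kdelta x y)) := by
  have hG : ∀ t, Matrix.of (periodise₂ (side t) (kdelta (d := d))) *
      (1 : Matrix (Site d (side t)) (Site d (side t)) ℝ) = 1 := by
    intro t
    rw [Matrix.mul_one]
    ext a b
    rw [Matrix.of_apply, periodise₂_kdelta, Matrix.one_apply]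
  exact tendsto_torusGreen summable_abs_kdelta (fun t => isPeriodic₂_kdelta (side t)) (decay₂_kdelta 1) one_pos
    compKer_kdelta_kdelta hside hG x y

end Witness

end Literature.MathematicalPhysics.QuantumFieldTheory.Balaban1983to89.Beta
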